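import Mathlib.Analysis.Calculus.FDeriv.Comp
import Mathlib.Analysis.Calculus.Deriv.Comp
import Mathlib.Analysis.Calculus.Deriv.Add
import Mathlib.Analysis.Calculus.Deriv.Mul
import Literature.MathematicalPhysics.QuantumFieldTheory.Balaban1983to89.B12FirstExpansion34
import Literature.MathematicalPhysics.QuantumFieldTheory.Balaban1983to89.B12CauchyRemainder354

/-!
# `Balaban1983to89.B12FarTerms36` — [Balaban1987RG1] (3.6)–(3.8) p. 271: the far terms of the first expansion
(the gauge-invariance rewriting (3.6), the `t_□`-derivative (3.7), and the function `δ𝐇_j` (3.8))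

HONEST FRAMING (cell `lit-balaban`, verbatim): statement-level skeleton of published theorems with citation tags; proofs where landed; nothing here is a claim about the Yang–Mills mass gap.

CITATION HEADER.  T. Bałaban, *Renormalization group approach to lattice gauge field theories. I. Generation of
effective actions in a small field approximation and a coupling constant renormalization in four dimensions*,
Commun. Math. Phys. **109** (1987) 249–301, doi:10.1007/bf01215223 [Balaban1987RG1] (cell paper B12; held text
`paper:balaban1987-cmp109-rg-i-small-field`, journal page = PDF page + 248; the displays were READ AS AN IMAGE from
the page render `b2b-balaban-ref1/pages/1987-cmp109-rg-I-small-field/…-p023-x2.png` (p. 271), the OCR of the held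
text being unusable for (3.6)–(3.8)).  Unit `lit-balaban-p32` (Phase-2 seat, dependants-ranked ABSENT list),
SKELETON row `B12.Eq3.6-3.8` (owner r09, fold owner r20) — this file TYPES the three displays and PROVES (3.6) from
its two named inputs and (3.7) from Mathlib's chain rule, on the Mathlib-calculus model of the sibling module
`B12FirstExpansion34` (row `B12.Eq3.3-3.4`, display (3.4)), whose `t_□`-integrand is the object differentiated here;
the `t_□`-function produced by (3.7) is the `Φ` whose Cauchy-integral extension is (3.15)
(`B12CauchyRemainder354.deriv_eq_circleIntegral_315`).  The bound (3.9) of `δ𝐇_j` is the sibling module `B12Ineq39`.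

WHAT IS PRINTED (p. 271 [PDF 23], verbatim; `□̃`, `ζ_□` as on p. 270).  *«Terms with domains X satisfying the first
condition in (3.5) are simple to deal with, we have to write them only in a form in which the exponential factors
can be clearly seen. Making use of the gauge invariance, and denoting
  Q_j(η(t + t_□ζ_□)𝐇_k(B′)) = B_□,   Q_j(ηt𝐇_k(B′)) = B(t),
we have
  𝐄^{(j)}(X, U_j(exp iB_□ Ū^j_{k+1})) = 𝐄^{(j)}(X, exp iξ𝐇_j(B_□)U_{k+1}).   (3.6)
The function 𝐇_j depends on the configuration U_{k+1}. The expression on the right-hand side is differential with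
respect to t_□, at t_□ = 0, and this yields
  ⟨((δ/δ𝐀)𝐄^{(j)})(X, exp iξ𝐇_j(B(t))U_{k+1}), ⟨((δ/δB)𝐇_j)(B(t)), (d/dt_□)B_□|_{t_□=0}⟩⟩
    = (d/dt_□) 𝐄^{(j)}(X, exp iξ[𝐇_j(B(t)) + t_□⟨((δ/δB)𝐇_j)(B(t)), ⟨((δ/δ𝐀)Q_j)(ηt𝐇_k(B′)), L^jηζ_□𝐇_k(B′)⟩⟩]U_{k+1})|_{t_□=0}.   (3.7)
The derivative (δ/δB)𝐇_j is an exponentially decaying function, with the decay rate δ₀ on the ξ-scale, see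
Proposition 9, (190) [15]. Let us denote
  δ𝐇_j = ⟨((δ/δB)𝐇_j)(B(t)), ⟨((δ/δ𝐀)Q_j)(ηt𝐇_k(B′)), L^jηζ_□𝐇_k(B′)⟩⟩.   (3.8)»*
([15] = [Balaban1985Variational].)

HOW IT IS FORMALIZED (the dictionary; all modelling choices are here).  As in `B12FirstExpansion34`, the maps of the
paper are functions between normed spaces over a field `𝕜` (`𝕜 = ℝ` for the `t_□`-derivative inside (3.4), `𝕜 = ℂ`
for the analytic extension (3.15); every statement below is scalar-generic):
* `EA` ∋ 𝐀 — the fields `(t + t_□ζ_□)𝐇_k(B′)`; the `t_□`-line is `x + τ • v` with `x = t𝐇_k(B′)`, `v = ζ_□𝐇_k(B′)`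
  (literally the line `t • H + τ • Hloc □` of `B12FirstExpansion34.eq34`);
* `Q : EA → EB` — 𝐀 ↦ Q_j(η𝐀) (the averaging with the factor η absorbed, as in the sibling's `f`), so that
  `Bsq Q x v τ = Q (x + τ • v)` **is B_□** and `Q x` **is B(t)**; the inner pairing
  `⟨((δ/δ𝐀)Q_j)(ηt𝐇_k(B′)), L^jηζ_□𝐇_k(B′)⟩` of (3.7)/(3.8) is, by the equality of the two members of (3.7), the
  derivative `(d/dt_□)B_□|_{t_□=0}`, i.e. `fderiv 𝕜 Q x v` (`hasDerivAt_Bsq`) — print's normalisation of the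
  variational derivative `δ/δ𝐀` and the scale factors `η`, `L^jη` are thereby absorbed into `Q`, exactly as the factor
  η of `(d/dt) … Q_j(ηt𝐇_k(B′)) …` is absorbed into `⟨(δ/δ𝐇)𝐄^{(j)}, 𝐇_k(B′)⟩` in (3.4);
* `Hj : EB → EH` — «the function 𝐇_j» (B ↦ 𝐇_j(B), depending on U_{k+1});
* `G : EH → F` — 𝐇 ↦ 𝐄^{(j)}(X, exp iξ𝐇 U_{k+1}), so `((δ/δ𝐀)𝐄^{(j)})(X, exp iξ𝐇_j(B(t))U_{k+1})` paired with a
  field `w` is `fderiv 𝕜 G (Hj (Q x)) w`;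
* for (3.6): configurations `𝒰`, gauge transformations `𝒢` acting by `•` (`SMul 𝒢 𝒰`), `E : 𝒰 → F` the map
  U ↦ 𝐄^{(j)}(X, U), `rep : EB → 𝒰` the map B ↦ U_j(exp iB Ū^j_{k+1}), `chart : EH → 𝒰` the map 𝐇 ↦ exp iξ𝐇 U_{k+1}
  (so `G = E ∘ chart`, and the sibling's `f` is `E ∘ rep ∘ Q`).  The two inputs of «Making use of the gauge
  invariance … we have (3.6)» are NAMED HYPOTHESES (binders, not facts): `hE` — 𝐄^{(j)}(X, ·) is gauge invariant;
  `hrep` — on the domain `D` of fields B considered, U_j(exp iB Ū^j_{k+1}) is a gauge transform of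
  exp iξ𝐇_j(B)U_{k+1} (the representation of the minimal configurations by «the function 𝐇_j» of Sect. G [15], used
  already at (3.3) «where we have used the results of Sect. G [15], and the equality (97) [12]»; rows `B11.Prop9`,
  `B11.SectG`, `B7.Eq97` — NOT reproduced here).
Then: (3.6) is `eq36` (two lines from `hE`, `hrep`); (3.8) is the definition `deltaH`; the sentence «differential with
respect to t_□, at t_□ = 0, and this yields» + the left member of (3.7) is `hasDerivAt_lhs37` (chain rule through
`G ∘ Hj ∘ Bsq`), the right member is `hasDerivAt_rhs37`, and (3.7) itself is `eq37` / `deriv_eq37`; along the far term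
of (3.4) (the function `τ ↦ E (rep (Bsq Q x v τ))`, which is the sibling's integrand by `integrand34_eq_farTerm`) the
rewriting (3.6) holds near `t_□ = 0` (`eventuallyEq_eq36`) and gives `hasDerivAt_farTerm` / `deriv_farTerm_eq37`;
at `𝕜 = ℂ` the right member of (3.7) is the `Φ′(0)` of (3.15) (`eq37_circleIntegral`, by
`B12CauchyRemainder354.deriv_eq_circleIntegral_315`).  Differentiability of `Q` at `x`, of `Hj` at `B(t)` and of
`G` at `𝐇_j(B(t))` are hypotheses (print: analyticity of the averaging, of 𝐇_j on (170) [15], of 𝐄^{(j)} on (3.16)).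
NOT HERE: the bound (3.9) (module `B12Ineq39`), «the required bound for (3.7)» via the analyticity of 𝐄^{(j)}
((3.15)–(3.17), module `B12CauchyRemainder354`), the second case `X ⊂ □̃²` of (3.5) ((3.10) sqq.).  Everything is
PROVED from Mathlib (`HasFDerivAt.comp_hasDerivAt_of_eq`, `HasDerivAt.smul_const`); no carrier of the cell and no
named fact is introduced.
-/

namespace Literature.MathematicalPhysics.QuantumFieldTheory.Balaban1983to89.B12FarTerms36

open Set Filter Metric
open scoped Topology

/-! ## The objects B_□, B(t) and δ𝐇_j ((3.8)) -/

section Objects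

variable {𝕜 : Type*} [NontriviallyNormedField 𝕜]
  {EA EB EH F : Type*} [NormedAddCommGroup EA] [NormedSpace 𝕜 EA] [NormedAddCommGroup EB] [NormedSpace 𝕜 EB]
  [NormedAddCommGroup EH] [NormedSpace 𝕜 EH] [NormedAddCommGroup F] [NormedSpace 𝕜 F]

/-- **B_□** of p. 271 (the unnumbered display before (3.6)): `B_□ = Q_j(η(t + t_□ζ_□)𝐇_k(B′))` as a function of
`t_□ = τ`, along the line `x + τ • v` (`x = t𝐇_k(B′)`, `v = ζ_□𝐇_k(B′)`) through the averaging `Q` (𝐀 ↦ Q_j(η𝐀));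
`B(t) = Q_j(ηt𝐇_k(B′))` is its value at `t_□ = 0` (`Bsq_zero`). [cite: Balaban1987RG1, (3.6) p.271] -/
def Bsq (Q : EA → EB) (x v : EA) (τ : 𝕜) : EB :=
  Q (x + τ • v)

omit [NormedAddCommGroup EB] [NormedSpace 𝕜 EB] in
/-- Unfolding of `Bsq`. [cite: Balaban1987RG1, (3.6) p.271] -/
theorem Bsq_apply (Q : EA → EB) (x v : EA) (τ : 𝕜) : Bsq Q x v τ = Q (x + τ • v) := rfl

omit [NormedAddCommGroup EB] [NormedSpace 𝕜 EB] in
/-- `B_□|_{t_□ = 0} = B(t)`: `Bsq Q x v 0 = Q x`. [cite: Balaban1987RG1, (3.6) p.271] -/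
@[simp] theorem Bsq_zero (Q : EA → EB) (x v : EA) : Bsq Q x v (0 : 𝕜) = Q x := by
  simp [Bsq]

/-- `(d/dt_□) B_□|_{t_□=0} = ⟨((δ/δ𝐀)Q_j)(ηt𝐇_k(B′)), [ζ_□𝐇_k(B′)]⟩`: the derivative of `B_□` at `t_□ = 0` is the
differential of the averaging at `x` in the direction `v` — the inner pairing of (3.7)/(3.8), for `Q` differentiable
at `x`. [cite: Balaban1987RG1, (3.7) p.271] -/
theorem hasDerivAt_Bsq {Q : EA → EB} {x : EA} (v : EA) (hQ : DifferentiableAt 𝕜 Q x) :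
    HasDerivAt (Bsq Q x v) (fderiv 𝕜 Q x v) (0 : 𝕜) := by
  have hline : HasDerivAt (fun τ : 𝕜 => x + τ • v) v 0 := by
    simpa using (HasDerivAt.smul_const (hasDerivAt_id (0 : 𝕜)) v).const_add x
  exact hQ.hasFDerivAt.comp_hasDerivAt_of_eq 0 hline (by simp)

omit [NormedSpace 𝕜 EB] [NormedAddCommGroup F] [NormedSpace 𝕜 F] in
/-- `B_□` is continuous at `t_□ = 0` when the averaging is continuous at `x`. [cite: Balaban1987RG1, (3.6) p.271] -/
theorem continuousAt_Bsq {Q : EA → EB} {x : EA} (v : EA) (hQ : ContinuousAt Q x) :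
    ContinuousAt (Bsq Q x v) (0 : 𝕜) := by
  have hline : ContinuousAt (fun τ : 𝕜 => x + τ • v) 0 :=
    (continuousAt_const.add (continuousAt_id.smul continuousAt_const))
  have hx : (fun τ : 𝕜 => x + τ • v) 0 = x := by simp
  exact ContinuousAt.comp_of_eq hQ hline hx

variable (𝕜) in
/-- **(3.8)** p. 271: *«Let us denote δ𝐇_j = ⟨((δ/δB)𝐇_j)(B(t)), ⟨((δ/δ𝐀)Q_j)(ηt𝐇_k(B′)), L^jηζ_□𝐇_k(B′)⟩⟩»* —
the differential of «the function 𝐇_j» at `B(t) = Q x` applied to the derivative `(d/dt_□)B_□|_{t_□=0} = DQ(x)v`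
of `B_□` (`hasDerivAt_Bsq`). [cite: Balaban1987RG1, (3.8) p.271] -/
noncomputable def deltaH (Hj : EB → EH) (Q : EA → EB) (x v : EA) : EH :=
  fderiv 𝕜 Hj (Q x) (fderiv 𝕜 Q x v)

omit [NormedAddCommGroup F] [NormedSpace 𝕜 F] in
/-- Unfolding of (3.8). [cite: Balaban1987RG1, (3.8) p.271] -/
theorem deltaH_def (Hj : EB → EH) (Q : EA → EB) (x v : EA) :
    deltaH 𝕜 Hj Q x v = fderiv 𝕜 Hj (Q x) (fderiv 𝕜 Q x v) := rfl

omit [NormedAddCommGroup F] [NormedSpace 𝕜 F] in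
/-- (3.8) is the `t_□`-derivative of `𝐇_j(B_□)` at `t_□ = 0` (inner chain rule), for `Q` differentiable at `x` and
`𝐇_j` differentiable at `B(t)`. [cite: Balaban1987RG1, (3.8) p.271] -/
theorem hasDerivAt_Hj_Bsq {Hj : EB → EH} {Q : EA → EB} {x : EA} (v : EA) (hQ : DifferentiableAt 𝕜 Q x)
    (hHj : DifferentiableAt 𝕜 Hj (Q x)) :
    HasDerivAt (fun τ : 𝕜 => Hj (Bsq Q x v τ)) (deltaH 𝕜 Hj Q x v) 0 :=
  hHj.hasFDerivAt.comp_hasDerivAt_of_eq 0 (hasDerivAt_Bsq v hQ) (by simp)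

omit [NormedAddCommGroup F] [NormedSpace 𝕜 F] in
/-- (3.8) is linear in the direction `v = ζ_□𝐇_k(B′)` (so `Σ_□ δ𝐇_j(□)` is `δ𝐇_j` of `Σ_□ ζ_□𝐇_k(B′) = 𝐇_k(B′)`, cf.
the partition of unity of (3.4)). [cite: Balaban1987RG1, (3.8) p.271] -/
theorem deltaH_sum (Hj : EB → EH) (Q : EA → EB) (x : EA) {ι : Type*} (S : Finset ι) (vloc : ι → EA) :
    deltaH 𝕜 Hj Q x (∑ c ∈ S, vloc c) = ∑ c ∈ S, deltaH 𝕜 Hj Q x (vloc c) := by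
  simp only [deltaH, map_sum]

end Objects

/-! ## (3.7): the `t_□`-derivative at `t_□ = 0` -/

section Eq37

variable {𝕜 : Type*} [NontriviallyNormedField 𝕜]
  {EA EB EH F : Type*} [NormedAddCommGroup EA] [NormedSpace 𝕜 EA] [NormedAddCommGroup EB] [NormedSpace 𝕜 EB]
  [NormedAddCommGroup EH] [NormedSpace 𝕜 EH] [NormedAddCommGroup F] [NormedSpace 𝕜 F]

/-- **(3.7), left member**, with the sentence producing it: *«The expression on the right-hand side [of (3.6)] is
differential with respect to t_□, at t_□ = 0, and this yields»*
`⟨((δ/δ𝐀)𝐄^{(j)})(X, exp iξ𝐇_j(B(t))U_{k+1}), ⟨((δ/δB)𝐇_j)(B(t)), (d/dt_□)B_□|_{t_□=0}⟩⟩` — the chain rule for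
`t_□ ↦ G(𝐇_j(B_□))` at `t_□ = 0` (`G` = 𝐇 ↦ 𝐄^{(j)}(X, exp iξ𝐇 U_{k+1})), for `Q`, `𝐇_j`, `G` differentiable at
`x`, `B(t)`, `𝐇_j(B(t))`. [cite: Balaban1987RG1, (3.7) p.271] -/
theorem hasDerivAt_lhs37 {G : EH → F} {Hj : EB → EH} {Q : EA → EB} {x : EA} (v : EA)
    (hQ : DifferentiableAt 𝕜 Q x) (hHj : DifferentiableAt 𝕜 Hj (Q x)) (hG : DifferentiableAt 𝕜 G (Hj (Q x))) :
    HasDerivAt (fun τ : 𝕜 => G (Hj (Bsq Q x v τ))) (fderiv 𝕜 G (Hj (Q x)) (deltaH 𝕜 Hj Q x v)) 0 :=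
  hG.hasFDerivAt.comp_hasDerivAt_of_eq 0 (hasDerivAt_Hj_Bsq v hQ hHj) (by simp)

omit [NormedAddCommGroup EA] [NormedSpace 𝕜 EA] [NormedAddCommGroup EB] [NormedSpace 𝕜 EB] in
/-- **(3.7), right member**: `(d/dt_□) 𝐄^{(j)}(X, exp iξ[𝐇_j(B(t)) + t_□w]U_{k+1})|_{t_□=0} = ⟨DG(𝐇_j(B(t))), w⟩`
for any field `w` (in print `w = δ𝐇_j`), `G` differentiable at `h₀ = 𝐇_j(B(t))`. [cite: Balaban1987RG1, (3.7) p.271] -/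
theorem hasDerivAt_rhs37 {G : EH → F} {h₀ : EH} (w : EH) (hG : DifferentiableAt 𝕜 G h₀) :
    HasDerivAt (fun τ : 𝕜 => G (h₀ + τ • w)) (fderiv 𝕜 G h₀ w) 0 := by
  have hline : HasDerivAt (fun τ : 𝕜 => h₀ + τ • w) w 0 := by
    simpa using (HasDerivAt.smul_const (hasDerivAt_id (0 : 𝕜)) w).const_add h₀
  exact hG.hasFDerivAt.comp_hasDerivAt_of_eq 0 hline (by simp)

omit [NormedAddCommGroup EA] [NormedSpace 𝕜 EA] [NormedAddCommGroup EB] [NormedSpace 𝕜 EB] in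
/-- (3.7), right member, `deriv` form. [cite: Balaban1987RG1, (3.7) p.271] -/
theorem deriv_rhs37 {G : EH → F} {h₀ : EH} (w : EH) (hG : DifferentiableAt 𝕜 G h₀) :
    deriv (fun τ : 𝕜 => G (h₀ + τ • w)) 0 = fderiv 𝕜 G h₀ w :=
  (hasDerivAt_rhs37 w hG).deriv

/-- **(3.7)** p. 271 as printed — left member = right member:
`⟨DG(𝐇_j(B(t))), ⟨D𝐇_j(B(t)), (d/dt_□)B_□|₀⟩⟩ = (d/dt_□) G(𝐇_j(B(t)) + t_□δ𝐇_j)|_{t_□=0}` with `δ𝐇_j` of (3.8).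
[cite: Balaban1987RG1, (3.7) p.271] -/
theorem eq37 {G : EH → F} (Hj : EB → EH) (Q : EA → EB) (x v : EA) (hG : DifferentiableAt 𝕜 G (Hj (Q x))) :
    fderiv 𝕜 G (Hj (Q x)) (deltaH 𝕜 Hj Q x v)
      = deriv (fun τ : 𝕜 => G (Hj (Q x) + τ • deltaH 𝕜 Hj Q x v)) 0 :=
  (deriv_rhs37 (deltaH 𝕜 Hj Q x v) hG).symm

/-- (3.7) together with the sentence before it: the `t_□`-derivative at 0 of the right-hand side of (3.6),
`t_□ ↦ G(𝐇_j(B_□))`, equals the `t_□`-derivative at 0 of `t_□ ↦ G(𝐇_j(B(t)) + t_□δ𝐇_j)` — the first-order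
replacement of `𝐇_j(B_□)` by `𝐇_j(B(t)) + t_□δ𝐇_j` inside a derivative at `t_□ = 0`.
[cite: Balaban1987RG1, (3.7) p.271] -/
theorem deriv_eq37 {G : EH → F} {Hj : EB → EH} {Q : EA → EB} {x : EA} (v : EA)
    (hQ : DifferentiableAt 𝕜 Q x) (hHj : DifferentiableAt 𝕜 Hj (Q x)) (hG : DifferentiableAt 𝕜 G (Hj (Q x))) :
    deriv (fun τ : 𝕜 => G (Hj (Bsq Q x v τ))) 0
      = deriv (fun τ : 𝕜 => G (Hj (Q x) + τ • deltaH 𝕜 Hj Q x v)) 0 := by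
  rw [(hasDerivAt_lhs37 v hQ hHj hG).deriv, eq37 Hj Q x v hG]

end Eq37

/-! ## (3.6): «Making use of the gauge invariance» -/

section Eq36

variable {𝒰 𝒢 : Type*} [SMul 𝒢 𝒰] {EB EH F : Type*}

/-- **(3.6)** p. 271: *«Making use of the gauge invariance … we have
𝐄^{(j)}(X, U_j(exp iB_□ Ū^j_{k+1})) = 𝐄^{(j)}(X, exp iξ𝐇_j(B_□)U_{k+1})»* — from the two named inputs: `hE`, the gauge
invariance of `E` = U ↦ 𝐄^{(j)}(X, U) under the gauge transformations `𝒢` acting on configurations; `hrep`, on the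
domain `D` the configuration `rep B` = U_j(exp iB Ū^j_{k+1}) is a gauge transform of `chart (Hj B)` =
exp iξ𝐇_j(B)U_{k+1} («the function 𝐇_j», Sect. G of [Balaban1985Variational], as used at (3.3)); stated at any field
`B ∈ D` (in print `B = B_□`). [cite: Balaban1987RG1, (3.6) p.271] -/
theorem eq36 {E : 𝒰 → F} (hE : ∀ (g : 𝒢) (U : 𝒰), E (g • U) = E U) {rep : EB → 𝒰} {chart : EH → 𝒰}
    {Hj : EB → EH} {D : Set EB} (hrep : ∀ B ∈ D, ∃ g : 𝒢, rep B = g • chart (Hj B)) {B : EB} (hB : B ∈ D) :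
    E (rep B) = E (chart (Hj B)) := by
  obtain ⟨g, hg⟩ := hrep B hB
  rw [hg, hE]

variable {𝕜 : Type*} [NontriviallyNormedField 𝕜]
  {EA : Type*} [NormedAddCommGroup EA] [NormedSpace 𝕜 EA] [NormedAddCommGroup EB] [NormedSpace 𝕜 EB]
  [NormedAddCommGroup EH] [NormedSpace 𝕜 EH] [NormedAddCommGroup F] [NormedSpace 𝕜 F]

omit [NormedAddCommGroup EB] [NormedSpace 𝕜 EB] [NormedAddCommGroup EH] [NormedSpace 𝕜 EH] [NormedAddCommGroup F]
  [NormedSpace 𝕜 F] in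
/-- (3.6) along `B_□`: at every `t_□ = τ` with `B_□ ∈ D`,
`𝐄^{(j)}(X, U_j(exp iB_□ Ū^j_{k+1})) = 𝐄^{(j)}(X, exp iξ𝐇_j(B_□)U_{k+1})`. [cite: Balaban1987RG1, (3.6) p.271] -/
theorem eq36_Bsq {E : 𝒰 → F} (hE : ∀ (g : 𝒢) (U : 𝒰), E (g • U) = E U) {rep : EB → 𝒰} {chart : EH → 𝒰}
    {Hj : EB → EH} {D : Set EB} (hrep : ∀ B ∈ D, ∃ g : 𝒢, rep B = g • chart (Hj B)) {Q : EA → EB} {x v : EA}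
    {τ : 𝕜} (hτ : Bsq Q x v τ ∈ D) :
    E (rep (Bsq Q x v τ)) = E (chart (Hj (Bsq Q x v τ))) :=
  eq36 hE hrep hτ

omit [NormedSpace 𝕜 EB] [NormedAddCommGroup EH] [NormedSpace 𝕜 EH] [NormedAddCommGroup F] [NormedSpace 𝕜 F] in
/-- (3.6) holds for all `t_□` near `0` as soon as the domain `D` is a neighbourhood of `B(t) = Q x` and the averaging
is continuous at `x` (so `B_□ ∈ D` for small `t_□`): the two sides of (3.6) agree as germs at `t_□ = 0`, which is what
the differentiation «at t_□ = 0» of (3.7) uses. [cite: Balaban1987RG1, (3.6) p.271] -/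
theorem eventuallyEq_eq36 {E : 𝒰 → F} (hE : ∀ (g : 𝒢) (U : 𝒰), E (g • U) = E U) {rep : EB → 𝒰}
    {chart : EH → 𝒰} {Hj : EB → EH} {D : Set EB} (hrep : ∀ B ∈ D, ∃ g : 𝒢, rep B = g • chart (Hj B))
    {Q : EA → EB} {x : EA} (v : EA) (hD : D ∈ 𝓝 (Q x)) (hQ : ContinuousAt Q x) :
    (fun τ : 𝕜 => E (rep (Bsq Q x v τ))) =ᶠ[𝓝 0] fun τ : 𝕜 => E (chart (Hj (Bsq Q x v τ))) := by
  have hc : ContinuousAt (Bsq Q x v) (0 : 𝕜) := continuousAt_Bsq v hQ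
  have hmem : ∀ᶠ τ : 𝕜 in 𝓝 0, Bsq Q x v τ ∈ D := by
    refine hc.preimage_mem_nhds ?_
    simpa using hD
  exact hmem.mono fun τ hτ => eq36 hE hrep hτ

/-- **(3.6) ⇒ (3.7) for the far term**: the `t_□`-derivative at 0 of `𝐄^{(j)}(X, U_j(exp iB_□ Ū^j_{k+1}))` (the
integrand of (3.4)) is the left member of (3.7), `⟨DG(𝐇_j(B(t))), δ𝐇_j⟩` with `G = E ∘ chart`, given gauge invariance
(`hE`), the representation (`hrep`) on a neighbourhood `D` of `B(t)`, and differentiability of `Q`, `𝐇_j`, `G`.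
[cite: Balaban1987RG1, (3.7) p.271] -/
theorem hasDerivAt_farTerm {E : 𝒰 → F} (hE : ∀ (g : 𝒢) (U : 𝒰), E (g • U) = E U) {rep : EB → 𝒰}
    {chart : EH → 𝒰} {Hj : EB → EH} {D : Set EB} (hrep : ∀ B ∈ D, ∃ g : 𝒢, rep B = g • chart (Hj B))
    {Q : EA → EB} {x : EA} (v : EA) (hD : D ∈ 𝓝 (Q x)) (hQ : DifferentiableAt 𝕜 Q x)
    (hHj : DifferentiableAt 𝕜 Hj (Q x)) (hG : DifferentiableAt 𝕜 (fun h => E (chart h)) (Hj (Q x))) :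
    HasDerivAt (fun τ : 𝕜 => E (rep (Bsq Q x v τ)))
      (fderiv 𝕜 (fun h => E (chart h)) (Hj (Q x)) (deltaH 𝕜 Hj Q x v)) 0 :=
  (hasDerivAt_lhs37 (G := fun h => E (chart h)) v hQ hHj hG).congr_of_eventuallyEq
    (eventuallyEq_eq36 hE hrep v hD hQ.continuousAt)

/-- (3.6)–(3.8) assembled on the far term: `(d/dt_□) 𝐄^{(j)}(X, U_j(exp iB_□ Ū^j_{k+1}))|_{t_□=0}
= (d/dt_□) 𝐄^{(j)}(X, exp iξ[𝐇_j(B(t)) + t_□δ𝐇_j]U_{k+1})|_{t_□=0}` (both members of (3.7) as derivatives).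
[cite: Balaban1987RG1, (3.7) p.271] -/
theorem deriv_farTerm_eq37 {E : 𝒰 → F} (hE : ∀ (g : 𝒢) (U : 𝒰), E (g • U) = E U) {rep : EB → 𝒰}
    {chart : EH → 𝒰} {Hj : EB → EH} {D : Set EB} (hrep : ∀ B ∈ D, ∃ g : 𝒢, rep B = g • chart (Hj B))
    {Q : EA → EB} {x : EA} (v : EA) (hD : D ∈ 𝓝 (Q x)) (hQ : DifferentiableAt 𝕜 Q x)
    (hHj : DifferentiableAt 𝕜 Hj (Q x)) (hG : DifferentiableAt 𝕜 (fun h => E (chart h)) (Hj (Q x))) :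
    deriv (fun τ : 𝕜 => E (rep (Bsq Q x v τ))) 0
      = deriv (fun τ : 𝕜 => E (chart (Hj (Q x) + τ • deltaH 𝕜 Hj Q x v))) 0 := by
  rw [(hasDerivAt_farTerm hE hrep v hD hQ hHj hG).deriv,
    eq37 (G := fun h => E (chart h)) Hj Q x v hG]

end Eq36

/-! ## Knitting: the integrand of (3.4) (`B12FirstExpansion34`, `𝕜 = ℝ`) and the `Φ` of (3.15)
(`B12CauchyRemainder354`, `𝕜 = ℂ`) -/

section Knitting

variable {𝒰 𝒢 : Type*} [SMul 𝒢 𝒰]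
  {EA EB EH F : Type*} [NormedAddCommGroup EA] [NormedSpace ℝ EA] [NormedAddCommGroup EB] [NormedSpace ℝ EB]
  [NormedAddCommGroup EH] [NormedSpace ℝ EH] [NormedAddCommGroup F] [NormedSpace ℝ F]

omit [SMul 𝒢 𝒰] [NormedAddCommGroup EB] [NormedSpace ℝ EB] [NormedAddCommGroup EH] [NormedSpace ℝ EH]
  [NormedAddCommGroup F] [NormedSpace ℝ F] in
/-- The `t_□`-integrand of (3.4) IS the far term differentiated here: with the sibling's
`f = E ∘ rep ∘ Q` (𝐇 ↦ 𝐄^{(j)}(X, U_j(exp iQ_j(η𝐇)Ū^j_{k+1}))), `f(t • H + τ • Hloc) = E (rep (B_□(τ)))` for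
`x = t • H`, `v = Hloc` (definitional). [cite: Balaban1987RG1, (3.6) p.271] -/
theorem integrand34_eq_farTerm (E : 𝒰 → F) (rep : EB → 𝒰) (Q : EA → EB) (t : ℝ) (H Hloc : EA) :
    (fun τ : ℝ => (fun A : EA => E (rep (Q A))) (t • H + τ • Hloc))
      = fun τ : ℝ => E (rep (Bsq Q (t • H) Hloc τ)) := rfl

/-- **(3.4) ∘ (3.6)–(3.8)**, one cube: the integrand `(d/dt_□) f(t𝐇 + t_□ζ_□𝐇)|_{t_□=0}` of
`B12FirstExpansion34.eq34` for `f = E ∘ rep ∘ Q` equals `⟨DG(𝐇_j(B(t))), δ𝐇_j⟩`, `G = E ∘ chart`, under the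
hypotheses of `hasDerivAt_farTerm` at `x = t𝐇_k(B′)`, `v = ζ_□𝐇_k(B′)`. [cite: Balaban1987RG1, (3.7) p.271] -/
theorem integrand34_eq37 {E : 𝒰 → F} (hE : ∀ (g : 𝒢) (U : 𝒰), E (g • U) = E U) {rep : EB → 𝒰}
    {chart : EH → 𝒰} {Hj : EB → EH} {D : Set EB} (hrep : ∀ B ∈ D, ∃ g : 𝒢, rep B = g • chart (Hj B))
    {Q : EA → EB} {t : ℝ} {H : EA} (Hloc : EA) (hD : D ∈ 𝓝 (Q (t • H))) (hQ : DifferentiableAt ℝ Q (t • H))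
    (hHj : DifferentiableAt ℝ Hj (Q (t • H)))
    (hG : DifferentiableAt ℝ (fun h => E (chart h)) (Hj (Q (t • H)))) :
    deriv (fun τ : ℝ => (fun A : EA => E (rep (Q A))) (t • H + τ • Hloc)) 0
      = fderiv ℝ (fun h => E (chart h)) (Hj (Q (t • H))) (deltaH ℝ Hj Q (t • H) Hloc) := by
  rw [integrand34_eq_farTerm]
  exact (hasDerivAt_farTerm hE hrep Hloc hD hQ hHj hG).deriv

omit [SMul 𝒢 𝒰] [NormedAddCommGroup EB] [NormedSpace ℝ EB] [NormedAddCommGroup EH] [NormedSpace ℝ EH] in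
/-- Consistency with the sibling's fourth equality of (3.4): for `f = E ∘ rep ∘ Q` differentiable at `x = t𝐇`, the
sibling's value `⟨Df(x), Hloc⟩` (`B12FirstExpansion34.deriv_tbox`) is the derivative of the far term `τ ↦ E (rep
(B_□(τ)))` at 0. [cite: Balaban1987RG1, (3.6) p.271] -/
theorem deriv_farTerm_eq_tbox (E : 𝒰 → F) (rep : EB → 𝒰) (Q : EA → EB) {t : ℝ} {H : EA} (Hloc : EA)
    (hf : DifferentiableAt ℝ (fun A : EA => E (rep (Q A))) (t • H)) :
    deriv (fun τ : ℝ => E (rep (Bsq Q (t • H) Hloc τ))) 0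
      = fderiv ℝ (fun A : EA => E (rep (Q A))) (t • H) Hloc := by
  rw [← integrand34_eq_farTerm]
  exact B12FirstExpansion34.deriv_tbox Hloc hf

end Knitting

section Cauchy

open Complex

variable {EH F : Type*} [NormedAddCommGroup EH] [NormedSpace ℂ EH] [NormedAddCommGroup F] [NormedSpace ℂ F]
  [CompleteSpace F]

/-- **(3.7) → (3.15)** at `𝕜 = ℂ`: the right member of (3.7) is `Φ′(0)` for `Φ(t_□) = 𝐄^{(j)}(X, exp iξ[𝐇_j(B(t)) +
t_□δ𝐇_j]U_{k+1})` = `τ ↦ G(h₀ + τ • w)`; when `Φ` is holomorphic on `|t_□| < R` (print: the configuration stays in the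
space (3.16)), it «can be written as the Cauchy integral (1/2πi)∮_{|t_□|=r} dt_□ t_□⁻² Φ(t_□)» for `0 < r < R`
(`B12CauchyRemainder354.deriv_eq_circleIntegral_315`). [cite: Balaban1987RG1, (3.7) p.271] -/
theorem eq37_circleIntegral {G : EH → F} {h₀ : EH} (w : EH) (hG : DifferentiableAt ℂ G h₀) {r R : ℝ}
    (hr : 0 < r) (hrR : r < R) (hΦ : DifferentiableOn ℂ (fun τ : ℂ => G (h₀ + τ • w)) (ball 0 R)) :
    fderiv ℂ G h₀ w
      = (2 * Real.pi * I)⁻¹ • ∮ t in C(0, r), (1 / (t - 0) ^ 2) • G (h₀ + t • w) := by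
  rw [← deriv_rhs37 w hG]
  exact B12CauchyRemainder354.deriv_eq_circleIntegral_315 hr hrR hΦ

end Cauchy

end Literature.MathematicalPhysics.QuantumFieldTheory.Balaban1983to89.B12FarTerms36
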